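import Mathlib
import Summits.AtomisticToContinuum.Crystallization.Theorems.ChessboardParticlePlanesLjLaminarWindowsGlueC5
import Summits.AtomisticToContinuum.Crystallization.Theorems.ChessboardParticlePlanesLjLaminarWindowsPathCount
import Summits.AtomisticToContinuum.Crystallization.Theorems.ChessboardParticlePlanesLjLaminarWindowsMassBoundA
import HarnessLib

/-! # Mass bound in an all-spiky region — stub `stub_massBound` of line `Sketch` (skeleton rev. 14,
lead c8), crux `LjLaminarWindows` (stmt-AtomisticToContinuum-6711)

Stage A of the non-spiky-fraction argument: if every particle within `2L²` of `x p₀` is `θ`-spiky at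
scale `L`, then every closed `2L`-ball centred at a particle within `L²` of `x p₀` holds at most
`M₁ L` particles, `M₁ = 3·10⁶ m² R² (20 m + 11)`, `m = ⌈180/θ⌉₊ + 1`.  The collar inequality of part A
(`massBound_collar`, ring points + Bonferroni + thick circles) is turned into a uniform bound on the
`1.1L`-ball counts by a walk to a weighted maximiser (`massBound_walk`) and a cover by `0.9L`-balls. -/

noncomputable section

open scoped BigOperators
open Filter Topology
open Literature.MathematicalPhysics.StatisticalMechanics
open Summit.AtomisticToContinuum.Crystallization.Theorems.ChargedEnergyGapNegative

namespace Summit.AtomisticToContinuum.Crystallization.Theorems.LjLaminarWindowsSketch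

/-- `log L ≤ L/16 + 2` for `L > 0` (`log (L/16) ≤ L/16 - 1`, `log 16 = 4 log 2 < 3`). [folklore] -/
theorem massBound_log_le {L : ℝ} (hL : 0 < L) : Real.log L ≤ L / 16 + 2 := by
  have h1 : Real.log (L / 16) ≤ L / 16 - 1 := Real.log_le_sub_one_of_pos (by positivity)
  have h2 : Real.log (L / 16) = Real.log L - Real.log 16 := Real.log_div hL.ne' (by norm_num)
  have h3 : Real.log 16 = 4 * Real.log 2 := by
    rw [show (16 : ℝ) = 2 ^ 4 by norm_num, Real.log_pow]
    push_cast
    ring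
  linarith [Real.log_two_lt_d9]

/-- Packing of the `1.1L`-ball of a particle of a `7/10`-separated configuration: at most
`(22L/7 + 1)³ ≤ L⁴` particles for `L ≥ 64`. [folklore] -/
theorem massBound_ball_le_pow {N : ℕ} (x : Fin N → E3)
    (hsep : ∀ j k : Fin N, j ≠ k → (7 : ℝ) / 10 ≤ dist (x j) (x k)) {L : ℝ} (hL : 64 ≤ L)
    (y : Fin N) :
    ((Finset.univ.filter fun j : Fin N => dist (x j) (x y) ≤ 11 / 10 * L).card : ℝ) ≤ L ^ 4 := by
  have hL0 : 0 ≤ L := by linarith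
  have h := glue_ball_card_le N x (massBound_injective x hsep) (by norm_num : (0 : ℝ) < 7 / 10) hsep
    (x y) (L := 11 / 10 * L) (by positivity)
  have h1 : 2 * (11 / 10 * L) / (7 / 10) + 1 ≤ 4 * L := by
    rw [show 2 * (11 / 10 * L) / (7 / 10) = 22 / 7 * L by ring]
    linarith
  have h2 : (2 * (11 / 10 * L) / (7 / 10) + 1) ^ 3 ≤ (4 * L) ^ 3 :=
    pow_le_pow_left₀ (by positivity) h1 3
  have h3 : (4 * L) ^ 3 ≤ L ^ 4 := by
    rw [show (4 * L) ^ 3 = 64 * L ^ 3 by ring, show L ^ 4 = L * L ^ 3 by ring]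
    exact mul_le_mul_of_nonneg_right hL (by positivity)
  linarith

/-- **Walk to a weighted maximiser.** In a `7/10`-separated configuration with `L ≥ 64`, suppose the
collar inequality `180 #B_{0.9L}(a) ≤ #B_{1.1L}(a) + K` holds at every particle `a` within
`2L² - L/10` of `x p₀`.  Then `#B_{1.1L}(y₀) ≤ K` for every particle `y₀` within `L² + 2L` of `x p₀`:
at a maximiser `q*` of `y ↦ #B_{1.1L}(y) e^{-|x y - x y₀|/(2L)}` one has `|x q* - x y₀| ≤ L²/2 + 16 L`
(`#B_{1.1L} ≤ L⁴`), the `1.1L`-ball of `q*` is covered by `≤ 41` balls `B_{0.9L}(y)`, so some `a` there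
has `#B_{1.1L}(q*) ≤ 41 #B_{0.9L}(a)` while `#B_{1.1L}(a) ≤ 3 #B_{1.1L}(q*)`; the collar inequality at
`a` gives `57 #B_{0.9L}(a) ≤ K`. [folklore] -/
theorem massBound_walk {N : ℕ} (x : Fin N → E3)
    (hsep : ∀ j k : Fin N, j ≠ k → (7 : ℝ) / 10 ≤ dist (x j) (x k))
    {L K : ℝ} (hL : 64 ≤ L) (p₀ : Fin N)
    (hcollar : ∀ a : Fin N, dist (x a) (x p₀) ≤ 2 * L ^ 2 - L / 10 →
      180 * ((Finset.univ.filter fun j : Fin N => dist (x j) (x a) ≤ 9 / 10 * L).card : ℝ) ≤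
        ((Finset.univ.filter fun j : Fin N => dist (x j) (x a) ≤ 11 / 10 * L).card : ℝ) + K)
    (y₀ : Fin N) (hy₀ : dist (x y₀) (x p₀) ≤ L ^ 2 + 2 * L) :
    ((Finset.univ.filter fun j : Fin N => dist (x j) (x y₀) ≤ 11 / 10 * L).card : ℝ) ≤ K := by
  have hL0 : 0 < L := by linarith
  have hinj := massBound_injective x hsep
  obtain ⟨g, hg⟩ : ∃ g : Fin N → ℝ, ∀ y, g y =
      ((Finset.univ.filter fun j : Fin N => dist (x j) (x y) ≤ 11 / 10 * L).card : ℝ) :=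
    ⟨_, fun _ => rfl⟩
  obtain ⟨f, hf⟩ : ∃ f : Fin N → ℝ, ∀ y, f y =
      ((Finset.univ.filter fun j : Fin N => dist (x j) (x y) ≤ 9 / 10 * L).card : ℝ) :=
    ⟨_, fun _ => rfl⟩
  obtain ⟨Φ, hΦ⟩ : ∃ Φ : Fin N → ℝ, ∀ y, Φ y = g y * Real.exp (-(dist (x y) (x y₀) / (2 * L))) :=
    ⟨_, fun _ => rfl⟩
  rw [← hg]
  -- the weighted maximiser `qs`
  obtain ⟨qs, -, hqs⟩ := Finset.exists_max_image Finset.univ Φ ⟨y₀, Finset.mem_univ _⟩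
  have hg0 : ∀ y, 0 ≤ g y := fun y => by rw [hg]; exact Nat.cast_nonneg _
  have hf0 : ∀ y, 0 ≤ f y := fun y => by rw [hf]; exact Nat.cast_nonneg _
  have hg1 : 1 ≤ g y₀ := by
    rw [hg]
    have h : y₀ ∈ Finset.univ.filter fun j : Fin N => dist (x j) (x y₀) ≤ 11 / 10 * L := by
      refine Finset.mem_filter.2 ⟨Finset.mem_univ _, ?_⟩
      rw [dist_self]
      positivity
    exact_mod_cast Finset.card_pos.2 ⟨y₀, h⟩
  have hΦy₀ : Φ y₀ = g y₀ := by rw [hΦ, dist_self, zero_div, neg_zero, Real.exp_zero, mul_one]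
  set d : ℝ := dist (x qs) (x y₀) with hd
  have hd0 : 0 ≤ d := dist_nonneg
  have hmax : g y₀ ≤ g qs * Real.exp (-(d / (2 * L))) := by
    rw [← hΦy₀, hd, ← hΦ]
    exact hqs y₀ (Finset.mem_univ _)
  -- (b) the maximiser is not far: `d ≤ L²/2 + 16 L`
  have hexp : Real.exp (d / (2 * L)) ≤ L ^ 4 := by
    have h2 : 1 ≤ g qs * Real.exp (-(d / (2 * L))) := hg1.trans hmax
    have h3 : Real.exp (d / (2 * L)) * Real.exp (-(d / (2 * L))) = 1 := by
      rw [← Real.exp_add, add_neg_cancel, Real.exp_zero]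
    have h4 : g qs ≤ L ^ 4 := by rw [hg]; exact massBound_ball_le_pow x hsep hL qs
    calc Real.exp (d / (2 * L)) = Real.exp (d / (2 * L)) * 1 := (mul_one _).symm
      _ ≤ Real.exp (d / (2 * L)) * (g qs * Real.exp (-(d / (2 * L)))) :=
          mul_le_mul_of_nonneg_left h2 (Real.exp_pos _).le
      _ = g qs * (Real.exp (d / (2 * L)) * Real.exp (-(d / (2 * L)))) := by ring
      _ = g qs := by rw [h3, mul_one]
      _ ≤ L ^ 4 := h4
  have hdL : d ≤ L ^ 2 / 2 + 16 * L := by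
    have h4 : d / (2 * L) ≤ Real.log (L ^ 4) := by
      have h := Real.log_le_log (Real.exp_pos _) hexp
      rwa [Real.log_exp] at h
    rw [Real.log_pow] at h4
    push_cast at h4
    have h5 := massBound_log_le hL0
    have h6 : d / (2 * L) ≤ L / 4 + 8 := by linarith
    rw [div_le_iff₀ (by positivity)] at h6
    nlinarith
  -- cover of the `1.1L`-ball of `qs` by `0.9L`-balls
  set B : Finset (Fin N) := Finset.univ.filter fun j : Fin N => dist (x j) (x qs) ≤ 11 / 10 * L
    with hB
  obtain ⟨P, hPB, hPsep, hPcov⟩ := massBound_cover x B (ρ := 9 / 10 * L) (by positivity)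
  have hPcard : (P.card : ℝ) ≤ 41 := by
    have h := massBound_sep_card x hinj P (x qs) (r := 9 / 10 * L) (R' := 11 / 10 * L)
      (by positivity) (by positivity) (fun y hy => (Finset.mem_filter.1 (hPB hy)).2) hPsep
    have h' : (2 * (11 / 10 * L) / (9 / 10 * L) + 1) ^ 3 ≤ (41 : ℝ) := by
      rw [show 2 * (11 / 10 * L) / (9 / 10 * L) = 22 / 9 by field_simp; ring]
      norm_num
    exact h.trans h'
  have hqsB : qs ∈ B := by
    refine Finset.mem_filter.2 ⟨Finset.mem_univ _, ?_⟩
    rw [dist_self]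
    positivity
  obtain ⟨y₁, hy₁P, -⟩ := hPcov qs hqsB
  obtain ⟨a, haP, hamax⟩ := P.exists_max_image f ⟨y₁, hy₁P⟩
  have hcov : B ⊆ P.biUnion fun y =>
      Finset.univ.filter fun j : Fin N => dist (x j) (x y) ≤ 9 / 10 * L := by
    intro z hz
    obtain ⟨y, hyP, hzy⟩ := hPcov z hz
    exact Finset.mem_biUnion.2 ⟨y, hyP, Finset.mem_filter.2 ⟨Finset.mem_univ _, hzy⟩⟩
  have hgqs : g qs ≤ 41 * f a := by
    have h1 : B.card ≤
        ∑ y ∈ P, (Finset.univ.filter fun j : Fin N => dist (x j) (x y) ≤ 9 / 10 * L).card :=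
      (Finset.card_le_card hcov).trans Finset.card_biUnion_le
    have h2 : (B.card : ℝ) ≤ ∑ y ∈ P, f y := by
      have h1' : ((B.card : ℕ) : ℝ) ≤ ((∑ y ∈ P,
          (Finset.univ.filter fun j : Fin N => dist (x j) (x y) ≤ 9 / 10 * L).card : ℕ) : ℝ) := by
        exact_mod_cast h1
      rw [Nat.cast_sum] at h1'
      refine h1'.trans (le_of_eq (Finset.sum_congr rfl fun y _ => (hf y).symm))
    have h3 : ∑ y ∈ P, f y ≤ ∑ y ∈ P, f a := Finset.sum_le_sum fun y hy => hamax y hy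
    rw [Finset.sum_const, nsmul_eq_mul] at h3
    have h4 : g qs = (B.card : ℝ) := by rw [hg]
    calc g qs = (B.card : ℝ) := h4
      _ ≤ P.card * f a := h2.trans h3
      _ ≤ 41 * f a := mul_le_mul_of_nonneg_right hPcard (hf0 a)
  -- (c) `g a ≤ 3 g qs`
  have haqs : dist (x a) (x qs) ≤ 11 / 10 * L := (Finset.mem_filter.1 (hPB haP)).2
  have hga : g a ≤ 3 * g qs := by
    have h1 : Φ a ≤ Φ qs := hqs a (Finset.mem_univ _)
    rw [hΦ, hΦ] at h1
    have h2 : dist (x a) (x y₀) ≤ 11 / 10 * L + d :=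
      (dist_triangle (x a) (x qs) (x y₀)).trans (by linarith)
    have h3 : Real.exp (-((11 / 10 * L + d) / (2 * L))) ≤
        Real.exp (-(dist (x a) (x y₀) / (2 * L))) := by
      apply Real.exp_le_exp.2
      have := div_le_div_of_nonneg_right h2 (by positivity : (0 : ℝ) ≤ 2 * L)
      linarith
    have h4 : g a * Real.exp (-((11 / 10 * L + d) / (2 * L))) ≤
        g qs * Real.exp (-(d / (2 * L))) :=
      (mul_le_mul_of_nonneg_left h3 (hg0 a)).trans h1
    have h5 : Real.exp (-((11 / 10 * L + d) / (2 * L))) =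
        Real.exp (-(11 / 20)) * Real.exp (-(d / (2 * L))) := by
      rw [← Real.exp_add]
      congr 1
      field_simp
      ring
    rw [h5, ← mul_assoc] at h4
    have h6 : g a * Real.exp (-(11 / 20)) ≤ g qs := le_of_mul_le_mul_right h4 (Real.exp_pos _)
    have h7 : (1 : ℝ) / 3 ≤ Real.exp (-(11 / 20)) := by
      have h8 : Real.exp (11 / 20) ≤ 3 :=
        (Real.exp_le_exp.2 (by norm_num : (11 : ℝ) / 20 ≤ 1)).trans
          (Real.exp_one_lt_d9.trans (by norm_num)).le
      rw [Real.exp_neg, ← one_div]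
      exact one_div_le_one_div_of_le (Real.exp_pos _) h8
    nlinarith [hg0 a]
  -- the collar inequality at `a`
  have hap₀ : dist (x a) (x p₀) ≤ 2 * L ^ 2 - L / 10 := by
    have h1 := dist_triangle (x a) (x qs) (x p₀)
    have h2 := dist_triangle (x qs) (x y₀) (x p₀)
    nlinarith
  have hc : 180 * f a ≤ g a + K := by rw [hf, hg]; exact hcollar a hap₀
  have hgy₀ : g y₀ ≤ g qs :=
    hmax.trans (mul_le_of_le_one_right (hg0 qs) (Real.exp_le_one_iff.2 (by
      rw [neg_nonpos]; positivity)))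
  linarith

/-- **Stage A — mass bound in an all-spiky region (registered stub `stub_massBound` of line `Sketch`).**
For `θ ∈ (0,1)`, `R ≥ 1` there are `M₁ > 0` and `L₁` such that for `L ≥ L₁`, in every finite
`7/10`-separated `23/20`-connected configuration: if every particle within `2L²` of `x_{p₀}` is
`θ`-spiky at scale `L` (shell `(L − R, L]`), then every closed `2L`-ball centred at a particle within
`L²` of `x_{p₀}` holds at most `M₁ L` particles.  Here `m = ⌈180/θ⌉₊ + 1`, `L₁ = 40(2m+1)R + 64`,
`M₁ = 3·10⁶ m² R² (20m + 11)`: the collar inequality (`massBound_collar`, with ring points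
`massBound_rings` at mutual distance `≥ L/(10(2m+1)) ≥ 4R` and the thick-circle count `hTC` for each
pair of ring shells) feeds `massBound_walk`, and the `2L`-ball is covered by `≤ 100` balls of radius
`1.1L` centred at particles. [folklore] -/
theorem stub_massBound
    (hTC : ∀ (N : ℕ) (x : Fin N → E3), (∀ j k : Fin N, j ≠ k → (7 : ℝ) / 10 ≤ dist (x j) (x k)) →
      ∀ (L R : ℝ), 1 ≤ R → 100 * R ≤ L →
      ∀ (q q' z : E3) (r : ℝ), 4 * R ≤ dist q q' → dist q q' ≤ L / 2 → 0 ≤ r →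
        ((Finset.univ.filter fun j : Fin N =>
            (L - R < dist (x j) q ∧ dist (x j) q ≤ L) ∧ (L - R < dist (x j) q' ∧ dist (x j) q' ≤ L) ∧
              dist (x j) z ≤ r).card : ℝ) ≤
          10000 * (r + Real.sqrt (L * R)) * R ^ 2 * (L / dist q q' + 1))
    (hBonf : ∀ (N m : ℕ) (A : ℕ → Finset (Fin N)),
      ∑ i ∈ Finset.range m, ((A i).card : ℝ) ≤
        (((Finset.range m).biUnion A).card : ℝ) +
          ∑ i ∈ Finset.range m, ∑ j ∈ Finset.range i, ((A i ∩ A j).card : ℝ)) :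
    ∀ θ R : ℝ, 0 < θ → θ < 1 → 1 ≤ R → ∃ M₁ L₁ : ℝ, 0 < M₁ ∧ ∀ L : ℝ, L₁ ≤ L →
      ∀ (N : ℕ) (x : Fin N → E3),
      (∀ j k : Fin N, j ≠ k → (7 : ℝ) / 10 ≤ dist (x j) (x k)) →
      (∀ S : Finset (Fin N), S.Nonempty → Sᶜ.Nonempty →
          ∃ p ∈ S, ∃ k ∈ Sᶜ, dist (x p) (x k) ≤ 23 / 20) →
      ∀ p₀ : Fin N,
        (∀ p : Fin N, dist (x p) (x p₀) ≤ 2 * L ^ 2 →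
          θ * ((Finset.univ.filter fun q : Fin N => dist (x q) (x p) ≤ L).card : ℝ) <
            ((Finset.univ.filter fun q : Fin N =>
              L - R < dist (x q) (x p) ∧ dist (x q) (x p) ≤ L).card : ℝ)) →
        ∀ q : Fin N, dist (x q) (x p₀) ≤ L ^ 2 →
          ((Finset.univ.filter fun j : Fin N => dist (x j) (x q) ≤ 2 * L).card : ℝ) ≤ M₁ * L := by
  intro θ R hθ _ hR
  set m : ℕ := ⌈180 / θ⌉₊ + 1 with hm
  have hm1 : (1 : ℝ) ≤ m := by
    rw [hm]
    exact_mod_cast Nat.le_add_left 1 _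
  have hmθ : 180 ≤ (m : ℝ) * θ := by
    have h1 : 180 / θ ≤ (⌈180 / θ⌉₊ : ℝ) := Nat.le_ceil _
    have h2 : (m : ℝ) = (⌈180 / θ⌉₊ : ℝ) + 1 := by rw [hm]; push_cast; ring
    rw [div_le_iff₀ hθ] at h1
    rw [h2]
    nlinarith
  have hR0 : 0 < R := by linarith
  refine ⟨3000000 * (m : ℝ) ^ 2 * R ^ 2 * (20 * m + 11), 40 * (2 * m + 1) * R + 64,
    by positivity, ?_⟩
  intro L hL N x hsep hconn p₀ hspiky q hq
  have hpos : (0 : ℝ) ≤ 40 * (2 * m + 1) * R := by positivity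
  have hL64 : 64 ≤ L := by linarith
  have hLR : 40 * (2 * m + 1) * R ≤ L := by linarith
  have hmR : R ≤ m * R := le_mul_of_one_le_left hR0.le hm1
  have hRL : 100 * R ≤ L := by nlinarith
  have hL0 : 0 < L := by linarith
  -- the ring spacing `D`
  set D : ℝ := L / (10 * (2 * m + 1)) with hD
  have hD0 : 0 < D := by positivity
  have hmD : (2 * m + 1) * D = L / 10 := by
    rw [hD]
    field_simp
  have hD4 : 4 * R ≤ D := by
    rw [hD, le_div_iff₀ (by positivity)]
    nlinarith
  have hD1 : 23 / 20 ≤ D := by linarith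
  have hLD : L / D = 10 * (2 * m + 1) := by
    rw [hD]
    field_simp
  set τ : ℝ := 30000 * L * R ^ 2 * (L / D + 1) with hτ
  have hτ0 : 0 ≤ τ := by positivity
  set K : ℝ := (m : ℝ) ^ 2 * τ with hK
  have hK0 : 0 ≤ K := by positivity
  -- Step 1: the collar inequality at every particle within `2L² - L/10` of `x p₀`
  have hcollar : ∀ a : Fin N, dist (x a) (x p₀) ≤ 2 * L ^ 2 - L / 10 →
      180 * ((Finset.univ.filter fun j : Fin N => dist (x j) (x a) ≤ 9 / 10 * L).card : ℝ) ≤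
        ((Finset.univ.filter fun j : Fin N => dist (x j) (x a) ≤ 11 / 10 * L).card : ℝ) + K := by
    intro a ha
    have hsp : ∀ p : Fin N, dist (x p) (x a) ≤ L / 10 →
        θ * ((Finset.univ.filter fun q : Fin N => dist (x q) (x p) ≤ L).card : ℝ) <
          ((Finset.univ.filter fun q : Fin N =>
            L - R < dist (x q) (x p) ∧ dist (x q) (x p) ≤ L).card : ℝ) := fun p hp =>
      hspiky p (by linarith [dist_triangle (x p) (x a) (x p₀)])
    -- `a` is spiky, so its shell holds a particle, which is far
    have hfar : ∃ j : Fin N, (2 * m + 1) * D ≤ dist (x j) (x a) := by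
      have h := hsp a (by rw [dist_self]; positivity)
      have hpos : (0 : ℝ) < ((Finset.univ.filter fun q : Fin N =>
          L - R < dist (x q) (x a) ∧ dist (x q) (x a) ≤ L).card : ℝ) :=
        lt_of_le_of_lt (by positivity) h
      have hpos' : 0 < (Finset.univ.filter fun q : Fin N =>
          L - R < dist (x q) (x a) ∧ dist (x q) (x a) ≤ L).card := by exact_mod_cast hpos
      obtain ⟨j, hj⟩ := Finset.card_pos.1 hpos'
      refine ⟨j, ?_⟩
      have h1 := (Finset.mem_filter.1 hj).2.1
      rw [hmD]
      linarith
    obtain ⟨Q, hQ⟩ := massBound_rings x hconn hD1 m a hfar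
    obtain ⟨hQa, hQQ⟩ := massBound_rings_dist x hD0.le m a Q hQ
    have hQa' : ∀ i < m, dist (x (Q i)) (x a) ≤ L / 10 := fun i hi => (hQa i hi).trans hmD.le
    have hI : ∀ i < m, ∀ j < i,
        (((Finset.univ.filter fun q : Fin N =>
            L - R < dist (x q) (x (Q i)) ∧ dist (x q) (x (Q i)) ≤ L) ∩
          (Finset.univ.filter fun q : Fin N =>
            L - R < dist (x q) (x (Q j)) ∧ dist (x q) (x (Q j)) ≤ L)).card : ℝ) ≤ τ := by
      intro i hi j hj
      obtain ⟨h1, h2⟩ := hQQ i hi j hj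
      rw [hmD] at h2
      exact massBound_pair hTC x hsep hR hRL hD0 (Q i) (Q j) (hD4.trans h1) h1 (by linarith)
    have hc := massBound_collar x hBonf hθ.le hτ0 m a Q hQa' (fun i hi => hsp (Q i) (hQa' i hi)) hI
    have hfa0 : (0 : ℝ) ≤
        ((Finset.univ.filter fun j : Fin N => dist (x j) (x a) ≤ 9 / 10 * L).card : ℝ) :=
      Nat.cast_nonneg _
    calc 180 * ((Finset.univ.filter fun j : Fin N => dist (x j) (x a) ≤ 9 / 10 * L).card : ℝ)
        ≤ (m : ℝ) * θ *
            ((Finset.univ.filter fun j : Fin N => dist (x j) (x a) ≤ 9 / 10 * L).card : ℝ) :=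
          mul_le_mul_of_nonneg_right hmθ hfa0
      _ ≤ _ := hc
  -- Step 2: uniform bound on the `1.1L`-ball counts near `x p₀`
  have hg : ∀ y : Fin N, dist (x y) (x p₀) ≤ L ^ 2 + 2 * L →
      ((Finset.univ.filter fun j : Fin N => dist (x j) (x y) ≤ 11 / 10 * L).card : ℝ) ≤ K :=
    fun y hy => massBound_walk x hsep hL64 p₀ hcollar y hy
  -- Step 3: cover the `2L`-ball of `q` by `≤ 100` balls of radius `1.1L` centred at particles
  set B₂ : Finset (Fin N) := Finset.univ.filter fun j : Fin N => dist (x j) (x q) ≤ 2 * L with hB₂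
  obtain ⟨P, hPB, hPsep, hPcov⟩ := massBound_cover x B₂ (ρ := 11 / 10 * L) (by positivity)
  have hPcard : (P.card : ℝ) ≤ 100 := by
    have h := massBound_sep_card x (massBound_injective x hsep) P (x q) (r := 11 / 10 * L)
      (R' := 2 * L) (by positivity) (by positivity)
      (fun y hy => (Finset.mem_filter.1 (hPB hy)).2) hPsep
    have h' : (2 * (2 * L) / (11 / 10 * L) + 1) ^ 3 ≤ (100 : ℝ) := by
      rw [show 2 * (2 * L) / (11 / 10 * L) = 40 / 11 by field_simp; ring]
      norm_num
    exact h.trans h'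
  have hcov : B₂ ⊆ P.biUnion fun y =>
      Finset.univ.filter fun j : Fin N => dist (x j) (x y) ≤ 11 / 10 * L := by
    intro z hz
    obtain ⟨y, hyP, hzy⟩ := hPcov z hz
    exact Finset.mem_biUnion.2 ⟨y, hyP, Finset.mem_filter.2 ⟨Finset.mem_univ _, hzy⟩⟩
  have h1 : B₂.card ≤
      ∑ y ∈ P, (Finset.univ.filter fun j : Fin N => dist (x j) (x y) ≤ 11 / 10 * L).card :=
    (Finset.card_le_card hcov).trans Finset.card_biUnion_le
  have h2 : (B₂.card : ℝ) ≤
      ∑ y ∈ P, ((Finset.univ.filter fun j : Fin N => dist (x j) (x y) ≤ 11 / 10 * L).card : ℝ) := by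
    exact_mod_cast h1
  have h3 : ∑ y ∈ P, ((Finset.univ.filter fun j : Fin N => dist (x j) (x y) ≤ 11 / 10 * L).card : ℝ)
      ≤ ∑ y ∈ P, K := by
    refine Finset.sum_le_sum fun y hy => hg y ?_
    have hyq : dist (x y) (x q) ≤ 2 * L := (Finset.mem_filter.1 (hPB hy)).2
    linarith [dist_triangle (x y) (x q) (x p₀)]
  rw [Finset.sum_const, nsmul_eq_mul] at h3
  calc (B₂.card : ℝ) ≤ P.card * K := h2.trans h3
    _ ≤ 100 * K := mul_le_mul_of_nonneg_right hPcard hK0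
    _ = 3000000 * (m : ℝ) ^ 2 * R ^ 2 * (20 * m + 11) * L := by rw [hK, hτ, hLD]; ring

end Summit.AtomisticToContinuum.Crystallization.Theorems.LjLaminarWindowsSketch

end
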